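import Summits.HodgeConjecture.HodgeConjecture.Theorems.F0P3XiArchPacketOfRecord   -- ★ p820882 (K6 part 2): `archPacketAt`, `archPacketOfRecord`, read-backs
import Summits.HodgeConjecture.HodgeConjecture.Theorems.F0P3UnitaryLocOfRecord    -- ★ «UL» (p02 (g7)): `IsCohUnitaryClass`, `isCohUnitaryClass_archDegOneClass`, `unitaryLoc₀`
import HarnessLib

/-!
# THE ARCHIMEDEAN HALF OF LAW `UnitaryPacket` AT `packInf₀`: every member of `Π(ξ_ι)` of record is a coh-unitary class, GIVEN two clauses on the posited carriers

Cell `hodgecm-mathlib`, F0∕P3 «U3-mult», crux H413 (`stmt-HodgeConjecture-24833`), rung 4; F0P3-p01 (g8), K6 sequel for PLAN.F0P3g5 §1 row 10 (`unitaryPacket`, cat E: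
«`πn` arch member unitary by X1 EXIT 1; `πs = dsInf` posited ⇒ its unitarity rides (L6)∕(UP) clause»).  DEF LANE: two residual PREDICATES on the posited carriers
(`JInfCohUnitary`, `DsInfCohUnitary`) + theorems; no instance, no notation, no named fact, no `sorry`.

T5 v5 law `UnitaryPacket` (:412–413): `∀ ξ S x, ram ξ ⊆ S → expansion ξ S x ≠ 0 → UnitaryLoc S x`; at `𝔠₀`, `UnitaryLoc := unitaryLoc₀ L H` (★ «UL»:
`IsCohUnitaryClass x.1 ∧ ∀ v, (x.2 v).IsUnitarizable`) and `expansion ξ S x ≠ 0 ⇒ x.1 ∈ (packInf₀ ξ).members` (★ kit-parametric `coords_mem_of_expansion_ne_zero`).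
This file discharges the ARCHIMEDEAN coordinate: the members of `packInf₀ ξ = archPacketOfRecord ι μω jInf dsInf ξ` are
* ON the cohomological locus `πⁿ = [J^{sgnInf₀ ξ}]` = ★ X1′ `archDegOneClass …` — coh-unitary by ★ `isCohUnitaryClass_archDegOneClass` (a THEOREM);
* OFF it `πⁿ = jInf p q t`, and `πˢ = dsInf p q t` always — POSITED classes, whose unitarity is print-true [Rogawski1990 §12.3 p. 176: `J⁺_φ` (resp. `J⁻_φ`) is unitary
  iff `n = 1` (resp. `m = 1`), which HOLDS for the packet of a ONE-dimensional `ξ_ι` (`dim ξ(x,y,z) = |x − z|`, p. 175); `πˢ = D^∓_φ` discrete series, or `π²_φ`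
  tempered, §12.3 p. 177] and is carried by the two clauses `JInfCohUnitary jInf`, `DsInfCohUnitary dsInf` riding the ONE rung-0 existential with (L6).
Heads: `isCohUnitaryClass_of_mem_archPacketAt`, **`isCohUnitaryClass_of_mem_archPacketOfRecord`** (= the `x.1`-conjunct of `unitaryLoc₀` for any member of `packInf₀ ξ`).

References: [Rogawski1990] §12.3 pp. 175–178 (unitarity of `J^±_φ`, the packets `Π(ξ_ι)`), Prop. 13.8.1 p. 206; [BorelWallach2000] 0 §2.5.
HC_CM is proved only modulo the printed citations until rung 0 closes.
-/

set_option autoImplicit false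
set_option linter.dupNamespace false

noncomputable section

open NumberField
open scoped Classical

namespace Summit.HodgeConjecture.HodgeConjecture.Cruxes.H413.F0P3XiArchPacketUnitary

open Literature.NumberTheory.Rogawski1990 Literature.NumberTheory.GaloisRepresentations Literature.NumberTheory.Automorphic
open Literature.RepresentationTheory.KonnoKonno2007
open Summit.HodgeConjecture.HodgeConjecture.Cruxes.H413.F0P3XiArchDataOfRecord
open Summit.HodgeConjecture.HodgeConjecture.Cruxes.H413.F0P3XiArchPacketOfRecord
open Summit.HodgeConjecture.HodgeConjecture.Cruxes.H413.F0P3UnitaryLocOfRecord (IsCohUnitaryClass isCohUnitaryClass_archDegOneClass)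

/-! ## §1 The two residual unitarity clauses on the posited carriers -/

/-- **`JInfCohUnitary jInf`** — OFF the cohomological locus the posited class `jInf p q t = [J^±_φ]` is coh-unitary (the class of an irreducible admissible
`(𝔲(2,1),K)`-module unitary along `𝔭`).  Print: `J⁺_φ` (resp. `J⁻_φ`) is unitary iff `n = 1` (resp. `m = 1`), automatic for the packet of a one-dimensional `ξ_ι`.
[cite: Rogawski1990, §12.3 p. 176] -/
def JInfCohUnitary (jInf : ℤ → ℤ → ℤ → GKIrrClass (uFormGroup (Fin 2) (Fin 1))) : Prop :=
  ∀ p q t : ℤ, ¬ ArchSignRecipe.IsCohTrivial p q t → IsCohUnitaryClass (jInf p q t)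

/-- **`DsInfCohUnitary dsInf`** — the posited second member `dsInf p q t = [D^∓_φ]` (discrete series) ∕ `[π²_φ]` (tempered) is coh-unitary.
[cite: Rogawski1990, §12.3 p. 177] -/
def DsInfCohUnitary (dsInf : ℤ → ℤ → ℤ → GKIrrClass (uFormGroup (Fin 2) (Fin 1))) : Prop :=
  ∀ p q t : ℤ, IsCohUnitaryClass (dsInf p q t)

/-! ## §2 Every member of the packet of record is coh-unitary -/

variable (jInf dsInf : ℤ → ℤ → ℤ → GKIrrClass (uFormGroup (Fin 2) (Fin 1)))

/-- `πⁿ` of `Π(p,q,t)` is coh-unitary: on the locus by ★ `isCohUnitaryClass_archDegOneClass` (theorem), off it by the clause. [cite: Rogawski1990, §12.3 p. 176] -/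
theorem isCohUnitaryClass_πn_archPacketAt (hJU : JInfCohUnitary jInf) (p q t : ℤ) : IsCohUnitaryClass (archPacketAt jInf dsInf p q t).πn := by
  by_cases h : ArchSignRecipe.IsCohTrivial p q t
  · rw [archPacketAt_πn_of jInf dsInf h]
    exact isCohUnitaryClass_archDegOneClass _ _
  · rw [archPacketAt_πn_of_not jInf dsInf h]
    exact hJU p q t h

/-- **Every member of `Π(p,q,t)` is coh-unitary**, given the two clauses. [cite: Rogawski1990, §12.3 pp. 176–177] -/
theorem isCohUnitaryClass_of_mem_archPacketAt (hJU : JInfCohUnitary jInf) (hDU : DsInfCohUnitary dsInf) (p q t : ℤ)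
    {x : GKIrrClass (uFormGroup (Fin 2) (Fin 1))} (hx : x ∈ (archPacketAt jInf dsInf p q t).members) : IsCohUnitaryClass x := by
  rcases (mem_archPacketAt_iff jInf dsInf p q t x).1 hx with rfl | rfl
  · exact isCohUnitaryClass_πn_archPacketAt jInf dsInf hJU p q t
  · exact hDU p q t

variable {L : Type} [Field L] [NumberField L] [IsCMField L] (ι : L →+* ℂ) (μω : HeckeCharacter L)

/-- **THE ARCHIMEDEAN HALF OF `UnitaryPacket` AT `packInf₀`**: every member of `packInf₀ ξ = archPacketOfRecord ι μω jInf dsInf ξ` is a coh-unitary class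
(the `x.1`-conjunct of ★ `unitaryLoc₀`), given the two clauses. [cite: Rogawski1990, §12.3 pp. 176–177; Prop. 13.8.1 p. 206] -/
theorem isCohUnitaryClass_of_mem_archPacketOfRecord (hJU : JInfCohUnitary jInf) (hDU : DsInfCohUnitary dsInf) (ξ : OneDimAutRepH L)
    {x : GKIrrClass (uFormGroup (Fin 2) (Fin 1))} (hx : x ∈ (archPacketOfRecord ι μω jInf dsInf ξ).members) : IsCohUnitaryClass x :=
  isCohUnitaryClass_of_mem_archPacketAt jInf dsInf hJU hDU _ _ _ hx

/-- In particular `πⁿ(ξ_ι)` of record is coh-unitary. [cite: Rogawski1990, §12.3 p. 176] -/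
theorem isCohUnitaryClass_πn_archPacketOfRecord (hJU : JInfCohUnitary jInf) (ξ : OneDimAutRepH L) :
    IsCohUnitaryClass (archPacketOfRecord ι μω jInf dsInf ξ).πn :=
  isCohUnitaryClass_πn_archPacketAt jInf dsInf hJU _ _ _

/-- On the cohomological locus NO clause is needed for `πⁿ(ξ_ι)`. [cite: Rogawski1990, §12.3 p. 178; Prop. 15.2.1 (b)] -/
theorem isCohUnitaryClass_πn_archPacketOfRecord_of_isCohTrivialAt (ξ : OneDimAutRepH L)
    (h : ξ.IsCohTrivialAt (ArchSignRecipe.tOfArchType (archTypeOfRecord μω) ι) ι) :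
    IsCohUnitaryClass (archPacketOfRecord ι μω jInf dsInf ξ).πn := by
  rw [archPacketOfRecord_πn_of_isCohTrivialAt jInf dsInf ι μω ξ h]
  exact isCohUnitaryClass_archDegOneClass _ _

end Summit.HodgeConjecture.HodgeConjecture.Cruxes.H413.F0P3XiArchPacketUnitary

end
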